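import Mathlib
import HarnessLib
import Summits.MatrixMultiplication.MatrixMultiplication.Theorems.OutsiderSandwichToricCeilingPowTwoCwBaseTwo
import Summits.MatrixMultiplication.MatrixMultiplication.Theorems.OutsiderSandwichToricCeilingPowThreeCwBaseCensus0C
import Summits.MatrixMultiplication.MatrixMultiplication.Theorems.OutsiderSandwichToricCeilingPowThreeCwBaseCensus1B
import Summits.MatrixMultiplication.MatrixMultiplication.Theorems.OutsiderSandwichToricCeilingPowThreeCwBaseCensus2C
import Summits.MatrixMultiplication.MatrixMultiplication.Theorems.OutsiderSandwichToricCeilingPowThreeCwBaseCensus3B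
import Summits.MatrixMultiplication.MatrixMultiplication.Theorems.OutsiderSandwichToricCeilingPowThreeCwBaseCensus4C
import Summits.MatrixMultiplication.MatrixMultiplication.Theorems.OutsiderSandwichToricCeilingPowThreeCwBaseCensus5C
import Summits.MatrixMultiplication.MatrixMultiplication.Theorems.OutsiderSandwichToricCeilingPowThreeCwBaseCensus6B

/-!
# OutsiderSandwich — toric ceiling of `cw₂^{⊠3}`: the THREE-cw base `cw ⊠ cw ⊠ cw` and the ceiling
`#Ψ ≤ 24` in EVERY product frame at `N = 3`
(decomp-mm lens 4 «minimal-counterexample / extremal reduction», gen 47, kernel K47-9; THESES-FREE,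
`ω`-free; helper toward `LaserTangency`, stmt-32268)

LABEL.  TORIC · FINITE (`N = 3`) · NEC-side instrument; the rates of `h₁ = LaserTangency` are
untouched; nothing here is implied by or implies `ω = 2`.

WHAT.  The kernel-decided PAIR census `…ThreeCwBaseCensus0A–6B` (5 256 canonical co-size-2 instances of
`cw ⊠ cw ⊠ cw = cw₂^{⊠3}` in its own basis, two certified distinct perfect matchings each), the
48-element symmetry group of `…ThreeCwBaseDefs` realised on words (`φ₁`, via `…PowTransport`), and
the pair transport of `…TwoCwBaseTwo` give
* `cccBase₂` — every lawful co-size-2 complement of `frame κ₁`, `κ₁ = (cw, cw, cw)`, has two distinct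
  perfect matchings;
* `productFrame_threeCw_three_no_diagonal_comb_degeneration_sub_two` — no diagonal comb degeneration
  `Ψ ⊴ frame κ₁` has `#Ψ ≥ 25`;
* `productFrame_three_no_diagonal_comb_degeneration_sub_two` — **for EVERY basis `κ : Fin 3 → Bool`,
  no diagonal comb degeneration `Ψ ⊴ frame κ` of `cw₂^{⊠3}` has `#Ψ ≥ 25`**, i.e. the degeneration
  column of `cw₂^{⊠3}` is `≤ 24 = 3^3 − 3` in every product frame (≤ 2 cw coordinates:
  `…TwoCwBaseTwo`, K47-8; three: this file).  This is critic g21's ask (1) in full (the `N = 3`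
  all-basis census, matchings supplied as data and only checked in the kernel) and closes the `N = 3`
  column of the lens-4 degeneration-column conjecture; `≥ 3` cw coordinates at `N ≥ 4` stay open.

CHECKS.  Standard axioms only; no `native_decide`.
-/

set_option linter.dupNamespace false
set_option maxRecDepth 4000

namespace Summit.MatrixMultiplication.MatrixMultiplication.Theorems.OutsiderSandwichToricCeilingPowThreeCwBase

open Finset
open Summit.MatrixMultiplication.MatrixMultiplication.Theorems.OutsiderSandwichToricCeilingPowFibres
  (Word Tr3 slotB frame)
open Summit.MatrixMultiplication.MatrixMultiplication.Theorems.OutsiderSandwichToricCeilingPowMixedGlue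
open Summit.MatrixMultiplication.MatrixMultiplication.Theorems.OutsiderSandwichToricCeilingPowMixedRules
open Summit.MatrixMultiplication.MatrixMultiplication.Theorems.OutsiderSandwichToricCeilingPowTransport
open Summit.MatrixMultiplication.MatrixMultiplication.Theorems.OutsiderSandwichToricCeilingPowTwoCwBaseDefs
open Summit.MatrixMultiplication.MatrixMultiplication.Theorems.OutsiderSandwichToricCeilingPowThreeCwBaseDefs
open Summit.MatrixMultiplication.MatrixMultiplication.Theorems.OutsiderSandwichToricCeilingPowThreeCwBaseCensus0A (lenc0)
open Summit.MatrixMultiplication.MatrixMultiplication.Theorems.OutsiderSandwichToricCeilingPowThreeCwBaseCensus0C (cover₃_0)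
open Summit.MatrixMultiplication.MatrixMultiplication.Theorems.OutsiderSandwichToricCeilingPowThreeCwBaseCensus1A (lenc1)
open Summit.MatrixMultiplication.MatrixMultiplication.Theorems.OutsiderSandwichToricCeilingPowThreeCwBaseCensus1B (cover₃_1)
open Summit.MatrixMultiplication.MatrixMultiplication.Theorems.OutsiderSandwichToricCeilingPowThreeCwBaseCensus2A (lenc2)
open Summit.MatrixMultiplication.MatrixMultiplication.Theorems.OutsiderSandwichToricCeilingPowThreeCwBaseCensus2C (cover₃_2)
open Summit.MatrixMultiplication.MatrixMultiplication.Theorems.OutsiderSandwichToricCeilingPowThreeCwBaseCensus3A (lenc3)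
open Summit.MatrixMultiplication.MatrixMultiplication.Theorems.OutsiderSandwichToricCeilingPowThreeCwBaseCensus3B (cover₃_3)
open Summit.MatrixMultiplication.MatrixMultiplication.Theorems.OutsiderSandwichToricCeilingPowThreeCwBaseCensus4A (lenc4)
open Summit.MatrixMultiplication.MatrixMultiplication.Theorems.OutsiderSandwichToricCeilingPowThreeCwBaseCensus4C (cover₃_4)
open Summit.MatrixMultiplication.MatrixMultiplication.Theorems.OutsiderSandwichToricCeilingPowThreeCwBaseCensus5A (lenc5)
open Summit.MatrixMultiplication.MatrixMultiplication.Theorems.OutsiderSandwichToricCeilingPowThreeCwBaseCensus5C (cover₃_5)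
open Summit.MatrixMultiplication.MatrixMultiplication.Theorems.OutsiderSandwichToricCeilingPowThreeCwBaseCensus6A (lenc6)
open Summit.MatrixMultiplication.MatrixMultiplication.Theorems.OutsiderSandwichToricCeilingPowThreeCwBaseCensus6B (cover₃_6)
open Summit.MatrixMultiplication.MatrixMultiplication.Theorems.OutsiderSandwichToricCeilingPowTwoCwBase
  (injOn_leg image_leg mem_compl ne_of_lt enc_ne ltW_swap leP_total)
open Summit.MatrixMultiplication.MatrixMultiplication.Theorems.OutsiderSandwichToricCeilingPowTwoCwBaseTwo
  (dec3_injective toFinset_ne two_transport two_swapYZ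
    productFrame_atMostTwoCw_three_no_diagonal_comb_degeneration_sub_two)
open Summit.MatrixMultiplication.MatrixMultiplication.Theorems.OutsiderSandwichToricCeilingPow
  (productFrame_no_diagonal_comb_degeneration)
open Summit.MatrixMultiplication.MatrixMultiplication.Theorems.OutsiderSandwichToricUniqueness
  (no_comb_degeneration_of_two_matchings)
open Summit.MatrixMultiplication.MatrixMultiplication.Theorems.OutsiderSandwichToricComplement

/-! ## §1 The bridge for `κ₁` -/

/-- A checked coded row decodes to a row of `frame κ₁`. -/
theorem dec3_mem_frame₁ {t : T₃} (ht : rowOK₁ t = true) : dec3 t ∈ frame κ₁ := by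
  simp only [rowOK₁, Bool.and_eq_true] at ht
  rw [mem_frame]
  intro i
  fin_cases i
  · exact ht.1.1
  · exact ht.1.2
  · exact ht.2

/-- **BRIDGE.**  A list accepted by `valid₁` decodes to a perfect matching of `frame κ₁` minus the
three pairs of words. -/
theorem isPMκ_of_valid₁ {x₁ x₂ y₁ y₂ z₁ z₂ : Word 3} (hx : x₁ ≠ x₂) (hy : y₁ ≠ y₂) (hz : z₁ ≠ z₂)
    {M : List T₃} (hv : valid₁ (enc x₁, enc x₂) (enc y₁, enc y₂) (enc z₁, enc z₂) M = true) :
    isPMκ κ₁ (M.map dec3).toFinset {x₁, x₂} {y₁, y₂} {z₁, z₂} = true := by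
  simp only [valid₁, Bool.and_eq_true, List.all_eq_true, decide_eq_true_eq] at hv
  obtain ⟨hrow, hn₁, hn₂, hn₃, hlen⟩ := hv
  refine isPMκ_iff.2 ⟨?_, injOn_leg (f := fun t => t.1) (fun _ => rfl) hn₁,
    injOn_leg (f := fun t => t.2.1) (fun _ => rfl) hn₂,
    injOn_leg (f := fun t => t.2.2) (fun _ => rfl) hn₃,
    image_leg (f := fun t => t.1) (fun _ => rfl) hn₁ hlen hx
      fun t ht => ⟨(hrow t ht).2.1, (hrow t ht).2.2.1⟩,
    image_leg (f := fun t => t.2.1) (fun _ => rfl) hn₂ hlen hy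
      fun t ht => ⟨(hrow t ht).2.2.2.1, (hrow t ht).2.2.2.2.1⟩,
    image_leg (f := fun t => t.2.2) (fun _ => rfl) hn₃ hlen hz
      fun t ht => ⟨(hrow t ht).2.2.2.2.2.1, (hrow t ht).2.2.2.2.2.2⟩⟩
  intro u hu
  rw [List.mem_toFinset, List.mem_map] at hu
  obtain ⟨s, hs, rfl⟩ := hu
  exact dec3_mem_frame₁ (hrow s hs).1

/-! ## §2 Extraction from the pair census -/

/-- A lawful admissible instance with `x`-pair in `Xs` is enumerated by `instOf₁ Xs`. -/
theorem mem_instOf₁ {Xs : List (W₃ × W₃)} {x₁ x₂ y₁ y₂ z₁ z₂ : Word 3} (hX : (enc x₁, enc x₂) ∈ Xs)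
    (hadm : admissible ((enc x₁, enc x₂), (enc y₁, enc y₂), (enc z₁, enc z₂)) = true)
    (hlaw : ∀ i, lawκ (κ₁ i) (x₁ i) (x₂ i) (y₁ i) (y₂ i) (z₁ i) (z₂ i) = true) :
    ((enc x₁, enc x₂), (enc y₁, enc y₂), (enc z₁, enc z₂)) ∈ instOf₁ Xs := by
  unfold instOf₁
  refine List.mem_flatMap.2 ⟨_, hX, List.mem_flatMap.2 ⟨(y₁ 0, y₂ 0, z₁ 0, z₂ 0), mem_compl (hlaw 0),
    List.mem_flatMap.2 ⟨(y₁ 1, y₂ 1, z₁ 1, z₂ 1), mem_compl (hlaw 1),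
    List.mem_filterMap.2 ⟨(y₁ 2, y₂ 2, z₁ 2, z₂ 2), mem_compl (hlaw 2), ?_⟩⟩⟩⟩
  have e : mkI (enc x₁, enc x₂) (y₁ 0, y₂ 0, z₁ 0, z₂ 0) (y₁ 1, y₂ 1, z₁ 1, z₂ 1)
      (y₁ 2, y₂ 2, z₁ 2, z₂ 2) = ((enc x₁, enc x₂), (enc y₁, enc y₂), (enc z₁, enc z₂)) := rfl
  simp only [e, hadm, if_true]

/-- Indexed extraction from a chunk-decided pair census. -/
theorem goodP₁_getElem_of_chunks {Xs : List (W₃ × W₃)} {ds : List (ℕ × ℕ)}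
    (hcov : ∀ i < ds.length, ∃ lo n, lo ≤ i ∧ i < lo + n ∧
      ((((instOf₁ Xs).zip ds).drop lo).take n).all (fun p => goodP₁ p.1 p.2.1 p.2.2) = true)
    {i : ℕ} (h₁ : i < (instOf₁ Xs).length) (h₂ : i < ds.length) :
    goodP₁ (instOf₁ Xs)[i] ds[i].1 ds[i].2 = true := by
  obtain ⟨lo, n, hlo, hin, hall⟩ := hcov i h₂
  rw [List.all_eq_true] at hall
  obtain ⟨j, rfl⟩ := Nat.exists_eq_add_of_le hlo
  have h₃ : j < ((((instOf₁ Xs).zip ds).drop lo).take n).length := by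
    simp only [List.length_take, List.length_drop, List.length_zip]; omega
  have hm := List.getElem_mem h₃
  rw [List.getElem_take, List.getElem_drop, List.getElem_zip] at hm
  exact hall _ hm

/-- A chunk-decided group: every instance has a certified pair. -/
theorem pair_of_chunks₁ {Xs : List (W₃ × W₃)} {ds : List (ℕ × ℕ)}
    (hl : (instOf₁ Xs).length = ds.length)
    (hcov : ∀ i < ds.length, ∃ lo n, lo ≤ i ∧ i < lo + n ∧
      ((((instOf₁ Xs).zip ds).drop lo).take n).all (fun p => goodP₁ p.1 p.2.1 p.2.2) = true) :
    ∀ I ∈ instOf₁ Xs, ∃ n n', goodP₁ I n n' = true := by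
  intro I hI
  obtain ⟨i, hi, rfl⟩ := List.getElem_of_mem hI
  exact ⟨_, _, goodP₁_getElem_of_chunks hcov hi (by omega)⟩

/-- THE PAIR CENSUS, assembled: every enumerated instance of every canonical `x`-pair has a certified
pair of certificates. -/
theorem census_all₁ : ∀ X ∈ canonX₁, ∃ Xs, X ∈ Xs ∧ ∀ I ∈ instOf₁ Xs, ∃ n n', goodP₁ I n n' = true := by
  intro X hX
  rw [canonX₁_eq] at hX
  simp only [List.mem_append] at hX
  rcases hX with h | h | h | h | h | h | h
  exacts [⟨_, h, pair_of_chunks₁ lenc0 cover₃_0⟩, ⟨_, h, pair_of_chunks₁ lenc1 cover₃_1⟩,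
    ⟨_, h, pair_of_chunks₁ lenc2 cover₃_2⟩, ⟨_, h, pair_of_chunks₁ lenc3 cover₃_3⟩,
    ⟨_, h, pair_of_chunks₁ lenc4 cover₃_4⟩, ⟨_, h, pair_of_chunks₁ lenc5 cover₃_5⟩,
    ⟨_, h, pair_of_chunks₁ lenc6 cover₃_6⟩]

/-- CORE: an enumerated lawful instance has two distinct perfect matchings. -/
theorem core₁ {x₁ x₂ y₁ y₂ z₁ z₂ : Word 3} (hX : (enc x₁, enc x₂) ∈ canonX₁)
    (hadm : admissible ((enc x₁, enc x₂), (enc y₁, enc y₂), (enc z₁, enc z₂)) = true)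
    (hlaw : ∀ i, lawκ (κ₁ i) (x₁ i) (x₂ i) (y₁ i) (y₂ i) (z₁ i) (z₂ i) = true) :
    ∃ P₁ P₂, P₁ ≠ P₂ ∧ isPMκ κ₁ P₁ {x₁, x₂} {y₁, y₂} {z₁, z₂} = true ∧
      isPMκ κ₁ P₂ {x₁, x₂} {y₁, y₂} {z₁, z₂} = true := by
  obtain ⟨Xs, hXs, hgood⟩ := census_all₁ _ hX
  obtain ⟨n, n', hn⟩ := hgood _ (mem_instOf₁ hXs hadm hlaw)
  simp only [goodP₁, Bool.and_eq_true] at hn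
  have hadm' := hadm; simp only [admissible, Bool.and_eq_true] at hadm'
  exact ⟨_, _, toFinset_ne hn.2,
    isPMκ_of_valid₁ (ne_of_lt (canonX₁_lt _ hX)) (ne_of_lt hadm'.1.1) (ne_of_lt hadm'.1.2) hn.1.1,
    isPMκ_of_valid₁ (ne_of_lt (canonX₁_lt _ hX)) (ne_of_lt hadm'.1.1) (ne_of_lt hadm'.1.2) hn.1.2⟩

/-! ## §3 The symmetry group acting on words -/

/-- The letter part of a group element. [new] -/
def τ₁ (g : G₁) : Fin 3 → Equiv.Perm (Fin 3) := ![Lperm g.1, Lperm g.2.1, Lperm g.2.2.1]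

/-- The action on words: permute the coordinates, then relabel the letters. [new] -/
def φ₁ (g : G₁) : Word 3 ≃ Word 3 := (permW (σ₁ g.2.2.2)).trans (relabW (τ₁ g))

/-- Pointwise formula for `φ₁`. -/
theorem φ₁_apply (g : G₁) (w : Word 3) (i : Fin 3) : φ₁ g w i = τ₁ g i (w (σ₁ g.2.2.2 i)) := rfl

/-- Pointwise formula for `(φ₁ g)⁻¹`. -/
theorem φ₁_symm_apply (g : G₁) (w : Word 3) (i : Fin 3) :
    (φ₁ g).symm w i = (τ₁ g ((σ₁ g.2.2.2).symm i)).symm (w ((σ₁ g.2.2.2).symm i)) := rfl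

/-- The inverse letter maps preserve cw slots. -/
theorem slot_τ₁_symm (g : G₁) : ∀ j (a b c : Fin 3), slotB true a b c = true →
    slotB true ((τ₁ g j).symm a) ((τ₁ g j).symm b) ((τ₁ g j).symm c) = true := by
  intro j; fin_cases j
  · exact slot_Lmap g.1
  · exact slot_Lmap g.2.1
  · exact slot_Lmap g.2.2.1

/-- The letter maps preserve the cw letter law. -/
theorem law_τ₁ (g : G₁) : ∀ j (a b c d e f : Fin 3), lawκ true (τ₁ g j a) (τ₁ g j b) (τ₁ g j c)
    (τ₁ g j d) (τ₁ g j e) (τ₁ g j f) = lawκ true a b c d e f := by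
  intro j; fin_cases j
  · exact law_Lmap g.1
  · exact law_Lmap g.2.1
  · exact law_Lmap g.2.2.1

/-- The word action, read in codes, is `actW₁`. -/
theorem enc_φ₁ (g : G₁) (w : Word 3) : enc (φ₁ g w) = actW₁ g (enc w) := by
  rcases g with ⟨k₀, k₁, k₂, p⟩
  fin_cases p <;> rfl

/-- `(φ₁ g)⁻¹` preserves the frame. -/
theorem map3_φ₁_symm_mem (g : G₁) {t : Tr3 3} (ht : t ∈ frame κ₁) :
    map3 (φ₁ g).symm t ∈ frame κ₁ := by
  rw [mem_frame] at ht ⊢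
  intro i
  rw [map3_fst, map3_snd_fst, map3_snd_snd, φ₁_symm_apply, φ₁_symm_apply, φ₁_symm_apply]
  exact slot_τ₁_symm g _ _ _ _ (ht ((σ₁ g.2.2.2).symm i))

/-- `φ₁ g` preserves the letter law of `κ₁`. -/
theorem law_φ₁ (g : G₁) {x₁ x₂ y₁ y₂ z₁ z₂ : Word 3}
    (hlaw : ∀ i, lawκ (κ₁ i) (x₁ i) (x₂ i) (y₁ i) (y₂ i) (z₁ i) (z₂ i) = true) :
    ∀ i, lawκ (κ₁ i) (φ₁ g x₁ i) (φ₁ g x₂ i) (φ₁ g y₁ i) (φ₁ g y₂ i) (φ₁ g z₁ i) (φ₁ g z₂ i)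
      = true := by
  intro i
  simp only [φ₁_apply]
  have h := law_τ₁ g i (x₁ (σ₁ g.2.2.2 i)) (x₂ (σ₁ g.2.2.2 i)) (y₁ (σ₁ g.2.2.2 i))
    (y₂ (σ₁ g.2.2.2 i)) (z₁ (σ₁ g.2.2.2 i)) (z₂ (σ₁ g.2.2.2 i))
  change lawκ true _ _ _ _ _ _ = true
  rw [h]
  exact hlaw _

/-! ## §4 The three-cw base -/

/-- CANONICAL CASE. -/
theorem canonical_case₁ {x₁ x₂ y₁ y₂ z₁ z₂ : Word 3} (hX : (enc x₁, enc x₂) ∈ canonX₁) (hy : y₁ ≠ y₂)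
    (hz : z₁ ≠ z₂) (hlaw : ∀ i, lawκ (κ₁ i) (x₁ i) (x₂ i) (y₁ i) (y₂ i) (z₁ i) (z₂ i) = true) :
    ∃ P₁ P₂, P₁ ≠ P₂ ∧ isPMκ κ₁ P₁ {x₁, x₂} {y₁, y₂} {z₁, z₂} = true ∧
      isPMκ κ₁ P₂ {x₁, x₂} {y₁, y₂} {z₁, z₂} = true := by
  wlog hyo : ltW (enc y₁) (enc y₂) = true generalizing y₁ y₂
  · rw [pair_comm y₁]
    exact this hy.symm (fun i => lawκ_swap_y _ _ _ _ _ _ _ (hlaw i)) (ltW_swap hy hyo)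
  wlog hzo : ltW (enc z₁) (enc z₂) = true generalizing z₁ z₂
  · rw [pair_comm z₁]
    exact this hz.symm (fun i => lawκ_swap_z _ _ _ _ _ _ _ (hlaw i)) (ltW_swap hz hzo)
  rcases leP_total (enc y₁, enc y₂) (enc z₁, enc z₂) with hle | hle
  · exact core₁ hX (by simp only [admissible, hyo, hzo, hle, Bool.and_self]) hlaw
  · exact two_swapYZ (core₁ hX (by simp only [admissible, hyo, hzo, hle, Bool.and_self])
      fun i => lawκ_swap_yz _ _ _ _ _ _ _ (hlaw i))

/-- **TWO-NESS, frame `cw ⊠ cw ⊠ cw` (`N = 3`)**: every lawful co-size-2 complement has two distinct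
perfect matchings. -/
theorem cccBase₂ : ∀ x₁ x₂ y₁ y₂ z₁ z₂ : Word 3, x₁ ≠ x₂ → y₁ ≠ y₂ → z₁ ≠ z₂ →
    (∀ i, lawκ (κ₁ i) (x₁ i) (x₂ i) (y₁ i) (y₂ i) (z₁ i) (z₂ i) = true) →
    ∃ P₁ P₂, P₁ ≠ P₂ ∧ isPMκ κ₁ P₁ {x₁, x₂} {y₁, y₂} {z₁, z₂} = true ∧
      isPMκ κ₁ P₂ {x₁, x₂} {y₁, y₂} {z₁, z₂} = true := by
  intro x₁ x₂ y₁ y₂ z₁ z₂ hx hy hz hlaw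
  obtain ⟨g, hg⟩ := exists_canon₁ (enc x₁) (enc x₂) (enc_ne hx)
  rw [← enc_φ₁, ← enc_φ₁] at hg
  have hne : ∀ {u v : Word 3}, u ≠ v → φ₁ g u ≠ φ₁ g v := fun h e => h ((φ₁ g).injective e)
  have hlaw' := law_φ₁ g hlaw
  have key : ∃ P₁ P₂, P₁ ≠ P₂ ∧
      isPMκ κ₁ P₁ {φ₁ g x₁, φ₁ g x₂} {φ₁ g y₁, φ₁ g y₂} {φ₁ g z₁, φ₁ g z₂} = true ∧
      isPMκ κ₁ P₂ {φ₁ g x₁, φ₁ g x₂} {φ₁ g y₁, φ₁ g y₂} {φ₁ g z₁, φ₁ g z₂} = true := by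
    by_cases hxo : ltW (enc (φ₁ g x₁)) (enc (φ₁ g x₂)) = true
    · rw [sortP, if_pos hxo] at hg
      exact canonical_case₁ hg (hne hy) (hne hz) hlaw'
    · rw [sortP, if_neg hxo] at hg
      rw [pair_comm (φ₁ g x₁)]
      exact canonical_case₁ hg (hne hy) (hne hz) fun i => lawκ_swap_x _ _ _ _ _ _ _ (hlaw' i)
  have h := two_transport (κ := κ₁) (κ' := κ₁) (φ₁ g).symm (fun t ht => map3_φ₁_symm_mem g ht) key
  simpa only [Equiv.symm_apply_apply] using h

/-! ## §5 The ceilings at `N = 3` -/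

/-- **`N = 3`, basis `cw ⊠ cw ⊠ cw`: no diagonal comb degeneration `Ψ` with `#Ψ ≥ 25`.**
[TORIC · `N = 3` · NEC-side instrument] -/
theorem productFrame_threeCw_three_no_diagonal_comb_degeneration_sub_two {R : Type*} [CommRing R]
    [LinearOrder R] [IsStrictOrderedRing R]
    {Ψ : Finset (Tr3 3)} {a b c : Word 3 → R} (hsub : Ψ ⊆ frame κ₁)
    (hzero : ∀ t ∈ Ψ, a t.1 + b t.2.1 + c t.2.2 = 0)
    (hone : ∀ t ∈ frame κ₁, t ∉ Ψ → 1 ≤ a t.1 + b t.2.1 + c t.2.2)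
    (hdiag : ∀ t ∈ Ψ, ∀ t' ∈ Ψ, (t.1 = t'.1 ∨ t.2.1 = t'.2.1 ∨ t.2.2 = t'.2.2) → t = t')
    (hbig : 3 ^ 3 ≤ #Ψ + 2) : False := by
  by_cases h1 : 3 ^ 3 ≤ #Ψ + 1
  · exact productFrame_no_diagonal_comb_degeneration (by norm_num) κ₁ hsub hzero hone hdiag h1
  have hcard : #Ψ + 2 = 3 ^ 3 := by omega
  have jΨ₁ : Set.InjOn (fun t : Tr3 3 => t.1) Ψ := fun t ht t' ht' e => hdiag t ht t' ht' (Or.inl e)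
  have jΨ₂ : Set.InjOn (fun t : Tr3 3 => t.2.1) Ψ :=
    fun t ht t' ht' e => hdiag t ht t' ht' (Or.inr (Or.inl e))
  have jΨ₃ : Set.InjOn (fun t : Tr3 3 => t.2.2) Ψ :=
    fun t ht t' ht' e => hdiag t ht t' ht' (Or.inr (Or.inr e))
  obtain ⟨x₁, x₂, hx, hX⟩ := image_eq_sdiff_pair jΨ₁ hcard
  obtain ⟨y₁, y₂, hy, hY⟩ := image_eq_sdiff_pair jΨ₂ hcard
  obtain ⟨z₁, z₂, hz, hZ⟩ := image_eq_sdiff_pair jΨ₃ hcard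
  have hlaw : ∀ i, lawκ (κ₁ i) (x₁ i) (x₂ i) (y₁ i) (y₂ i) (z₁ i) (z₂ i) = true := fun i =>
    lawκ_of_counts _ _ _ _ _ _ _
      (fun hi α => two_missing_letters_dcoord κ₁ hsub jΨ₁ jΨ₂ jΨ₃ hx hy hz hX hY hZ i hi α)
      (fun hi => two_missing_letters_cwcoord κ₁ hsub jΨ₁ jΨ₂ jΨ₃ hx hy hz hX hY hZ i hi)
  obtain ⟨P₁, P₂, hne, h₁, h₂⟩ := cccBase₂ x₁ x₂ y₁ y₂ z₁ z₂ hx hy hz hlaw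
  obtain ⟨f₁, j₁₁, j₁₂, j₁₃, i₁₁, i₁₂, i₁₃⟩ := isPMκ_iff.1 h₁
  obtain ⟨f₂, j₂₁, j₂₂, j₂₃, i₂₁, i₂₂, i₂₃⟩ := isPMκ_iff.1 h₂
  exact no_comb_degeneration_of_two_matchings hne f₁ f₂ j₁₁ j₁₂ j₁₃ j₂₁ j₂₂ j₂₃
    (i₁₁.trans i₂₁.symm) (i₁₂.trans i₂₂.symm) (i₁₃.trans i₂₃.symm)
    ⟨Ψ, a, b, c, hzero, hone, jΨ₁, jΨ₂, jΨ₃, hX.trans i₁₁.symm, hY.trans i₁₂.symm,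
      hZ.trans i₁₃.symm⟩

/-- A basis of `Fin 3` which is not everywhere cw has at most two cw coordinates. -/
theorem atMostTwo_of_exists_false : ∀ κ : Fin 3 → Bool, (∃ i, κ i = false) →
    ∀ i j k, κ i = true → κ j = true → κ k = true → i = j ∨ j = k ∨ i = k := by
  decide

/-- **TORIC CEILING `⟨24⟩ = ⟨3^3 − 3⟩` FOR `cw₂^{⊠3}` IN EVERY PRODUCT FRAME — unconditional.**  For
every basis `κ : Fin 3 → Bool`, no diagonal comb degeneration `Ψ ⊴ frame κ` has `#Ψ ≥ 25`.
(≤ 2 cw coordinates: `…TwoCwBaseTwo`, K47-8; `cw ⊠ cw ⊠ cw`: the previous theorem.)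
[TORIC · `N = 3` · NEC-side instrument; the rates of `h₁ = LaserTangency` untouched] -/
theorem productFrame_three_no_diagonal_comb_degeneration_sub_two {R : Type*} [CommRing R]
    [LinearOrder R] [IsStrictOrderedRing R] (κ : Fin 3 → Bool)
    {Ψ : Finset (Tr3 3)} {a b c : Word 3 → R} (hsub : Ψ ⊆ frame κ)
    (hzero : ∀ t ∈ Ψ, a t.1 + b t.2.1 + c t.2.2 = 0)
    (hone : ∀ t ∈ frame κ, t ∉ Ψ → 1 ≤ a t.1 + b t.2.1 + c t.2.2)
    (hdiag : ∀ t ∈ Ψ, ∀ t' ∈ Ψ, (t.1 = t'.1 ∨ t.2.1 = t'.2.1 ∨ t.2.2 = t'.2.2) → t = t')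
    (hbig : 3 ^ 3 ≤ #Ψ + 2) : False := by
  by_cases hall : ∀ i, κ i = true
  · obtain rfl : κ = κ₁ := funext fun i => hall i
    exact productFrame_threeCw_three_no_diagonal_comb_degeneration_sub_two hsub hzero hone hdiag hbig
  · have hex : ∃ i, κ i = false := by
      by_contra h
      exact hall fun i => by
        cases hi : κ i
        · exact absurd ⟨i, hi⟩ h
        · rfl
    exact productFrame_atMostTwoCw_three_no_diagonal_comb_degeneration_sub_two κ
      (atMostTwo_of_exists_false κ hex) hsub hzero hone hdiag hbig

end Summit.MatrixMultiplication.MatrixMultiplication.Theorems.OutsiderSandwichToricCeilingPowThreeCwBase
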